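import Summits.MatrixMultiplication.MatrixMultiplication.Theorems.SoloInformedValCommonPeriod

/-!
# The grid lemma and half-equidistribution modulo `R_t + R_u`

Setting of `SoloInformedValFamilyCriterion` / `SoloInformedValCommonPeriod` (finite abelian group, identity potentials,
a family of complete blocks, the family criterion `M_t ⊥ U_t ⊥ V_t`; a 'period' of a set `D` is a finite set `R`,
closed under subtraction, with `D + R ⊆ D`).

`grid_disjoint` (GRID LEMMA): if `P` is `R₁`-saturated, `P'` is `R₂`-saturated (`R₁`, `R₂` closed under subtraction)
and `P ∩ P' = ∅`, then `P + (R₁ + R₂)` and `P' + (R₁ + R₂)` are still disjoint: a coincidence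
`p + r₁ + r₂ = p' + r₁' + r₂'` would give `p + (r₁ − r₁') = p' + (r₂' − r₂) ∈ P ∩ P'`.

`FamilyCriterionAt.two_mul_card_sumSet_periods_le` (HALF-EQUIDISTRIBUTION): if `R₁` is a period of `Y_t − Z_t` and `R₂`
a period of `Y_u − Z_u` for another block `u` (all four classes nonempty), then `2·|X_t + (R₁ + R₂)| ≤ |G|`: the mixed set
`M_t = X_t + (Y_t − Z_t)` is `R₁`-saturated, the part `X_t + (Y_u − Z_u)` of `U_t` is `R₂`-saturated, they are disjoint by
the criterion, so by the grid lemma their `(R₁ + R₂)`-saturations are disjoint — and each contains a translate of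
`X_t + (R₁ + R₂)`.  With `R₂ = {0}` and `Y_t − Z_t` a single `R₁`-coset this is the half-volume lemma again; the point is
that the modulus may be enlarged to `R₁ + R₂`, i.e. `X_t` occupies at most half of `G/(R_t + R_u)`.
`NoAccidental.two_mul_card_sumSet_periods_le` is the accidental-free form, and `card_mul_card_le_card_sumSet_periods`
records `|X_t|·|R₁| ≤ |X_t + (R₁ + R₂)|` (rows are incongruent modulo a period).
-/

namespace Summit.MatrixMultiplication.MatrixMultiplication.Theorems.SoloVal

open Finset

section GridLemma

variable {G : Type*} [AddCommGroup G] [DecidableEq G]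

/-- GRID LEMMA: saturated disjoint sets stay disjoint after saturating both by the sum of the two period sets. -/
theorem grid_disjoint {P P' R₁ R₂ : Finset G}
    (hR₁ : ∀ r ∈ R₁, ∀ s ∈ R₁, r - s ∈ R₁) (hR₂ : ∀ r ∈ R₂, ∀ s ∈ R₂, r - s ∈ R₂)
    (h₁ : ∀ p ∈ P, ∀ r ∈ R₁, p + r ∈ P) (h₂ : ∀ p ∈ P', ∀ r ∈ R₂, p + r ∈ P')
    (h : Disjoint P P') :
    Disjoint (sumSet P (sumSet R₁ R₂)) (sumSet P' (sumSet R₁ R₂)) := by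
  rw [Finset.disjoint_left]
  intro g hg hg'
  obtain ⟨p, hp, w, hw, rfl⟩ := mem_sumSet.mp hg
  obtain ⟨r₁, hr₁, r₂, hr₂, rfl⟩ := mem_sumSet.mp hw
  obtain ⟨p', hp', w', hw', hEq⟩ := mem_sumSet.mp hg'
  obtain ⟨r₁', hr₁', r₂', hr₂', rfl⟩ := mem_sumSet.mp hw'
  -- `p + (r₁ - r₁') = p' + (r₂' - r₂)` lies in both sets
  have hP : p + (r₁ - r₁') ∈ P := h₁ p hp _ (hR₁ r₁ hr₁ r₁' hr₁')
  have hP' : p' + (r₂' - r₂) ∈ P' := h₂ p' hp' _ (hR₂ r₂' hr₂' r₂ hr₂)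
  have hsame : p + (r₁ - r₁') = p' + (r₂' - r₂) := by
    have h0 : p' + (r₁' + r₂') = p + (r₁ + r₂) := hEq
    calc p + (r₁ - r₁') = p + (r₁ + r₂) - r₁' - r₂ := by abel
      _ = p' + (r₁' + r₂') - r₁' - r₂ := by rw [h0]
      _ = p' + (r₂' - r₂) := by abel
  rw [hsame] at hP
  exact Finset.disjoint_left.mp h hP hP'

/-- A sumset `X + D` is saturated under any period of `D`. -/
theorem sumSet_sat {X₀ D R : Finset G} (hsat : ∀ d ∈ D, ∀ r ∈ R, d + r ∈ D) :
    ∀ m ∈ sumSet X₀ D, ∀ r ∈ R, m + r ∈ sumSet X₀ D := by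
  intro m hm r hr
  obtain ⟨x, hx, d, hd, rfl⟩ := mem_sumSet.mp hm
  exact mem_sumSet.mpr ⟨x, hx, d + r, hsat d hd r hr, by abel⟩

/-- A translate of `X + W` by an element of `D` lies inside `(X + D) + W`. -/
theorem image_sumSet_translate_subset {X₀ D W : Finset G} {d : G} (hd : d ∈ D) :
    (sumSet X₀ W).image (fun g => g + d) ⊆ sumSet (sumSet X₀ D) W := by
  intro g hg
  obtain ⟨g₀, hg₀, rfl⟩ := Finset.mem_image.mp hg
  obtain ⟨x, hx, w, hw, rfl⟩ := mem_sumSet.mp hg₀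
  exact mem_sumSet.mpr ⟨x + d, mem_sumSet.mpr ⟨x, hx, d, hd, rfl⟩, w, hw, by abel⟩

variable {ι : Type*} [DecidableEq ι] {T : Finset ι} {X Y Z : ι → Finset G} {t u : ι}

/-- HALF-EQUIDISTRIBUTION modulo `R₁ + R₂`: under the family criterion at `t`, if `R₁` is a period of `Y_t − Z_t` and
`R₂` a period of `Y_u − Z_u` for a second block `u`, then `2·|X_t + (R₁ + R₂)| ≤ |G|`. -/
theorem FamilyCriterionAt.two_mul_card_sumSet_periods_le [Fintype G] (h : FamilyCriterionAt T X Y Z t)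
    {R₁ R₂ : Finset G} (hR₁ : ∀ r ∈ R₁, ∀ s ∈ R₁, r - s ∈ R₁) (hR₂ : ∀ r ∈ R₂, ∀ s ∈ R₂, r - s ∈ R₂)
    (hsat₁ : ∀ d ∈ diffSet (Y t) (Z t), ∀ r ∈ R₁, d + r ∈ diffSet (Y t) (Z t))
    (hsat₂ : ∀ d ∈ diffSet (Y u) (Z u), ∀ r ∈ R₂, d + r ∈ diffSet (Y u) (Z u))
    (hu : u ∈ T) (hut : u ≠ t) (hYt : (Y t).Nonempty) (hZt : (Z t).Nonempty)
    (hYu : (Y u).Nonempty) (hZu : (Z u).Nonempty) :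
    2 * (sumSet (X t) (sumSet R₁ R₂)).card ≤ Fintype.card G := by
  obtain ⟨yt, hyt⟩ := hYt
  obtain ⟨zt, hzt⟩ := hZt
  obtain ⟨yu, hyu⟩ := hYu
  obtain ⟨zu, hzu⟩ := hZu
  set W := sumSet R₁ R₂ with hW
  set M := sumSet (X t) (diffSet (Y t) (Z t)) with hM
  set P := sumSet (X t) (diffSet (Y u) (Z u)) with hP
  -- `M = M_t` and `P ⊆ U_t` are disjoint by the criterion
  have hMP : Disjoint M P := by
    have hMU := h.2.1
    rw [mixedImage_eq_sumSet_diffSet] at hMU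
    refine Finset.disjoint_of_subset_right ?_ hMU
    intro g hg
    obtain ⟨x, hx, d, hd, rfl⟩ := mem_sumSet.mp hg
    obtain ⟨y, hy, z, hz, rfl⟩ := mem_diffSet.mp hd
    exact mem_crossU.mpr ⟨x, hx, u, Finset.mem_erase.mpr ⟨hut, hu⟩, y, hy, z, hz, rfl⟩
  -- grid lemma
  have hgrid : Disjoint (sumSet M W) (sumSet P W) :=
    grid_disjoint hR₁ hR₂ (sumSet_sat hsat₁) (sumSet_sat hsat₂) hMP
  -- the two translates of `X_t + W`
  have hdt : yt - zt ∈ diffSet (Y t) (Z t) := mem_diffSet.mpr ⟨yt, hyt, zt, hzt, rfl⟩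
  have hdu : yu - zu ∈ diffSet (Y u) (Z u) := mem_diffSet.mpr ⟨yu, hyu, zu, hzu, rfl⟩
  set S₁ := (sumSet (X t) W).image (fun g => g + (yt - zt)) with hS₁
  set S₂ := (sumSet (X t) W).image (fun g => g + (yu - zu)) with hS₂
  have h1 : S₁ ⊆ sumSet M W := image_sumSet_translate_subset hdt
  have h2 : S₂ ⊆ sumSet P W := image_sumSet_translate_subset hdu
  have hS : Disjoint S₁ S₂ :=
    Finset.disjoint_of_subset_left h1 (Finset.disjoint_of_subset_right h2 hgrid)
  have hc1 : S₁.card = (sumSet (X t) W).card := Finset.card_image_of_injective _ (add_left_injective _)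
  have hc2 : S₂.card = (sumSet (X t) W).card := Finset.card_image_of_injective _ (add_left_injective _)
  calc 2 * (sumSet (X t) W).card = S₁.card + S₂.card := by rw [hc1, hc2]; ring
    _ = (S₁ ∪ S₂).card := (Finset.card_union_of_disjoint hS).symm
    _ ≤ Fintype.card G := Finset.card_le_univ _

/-- Accidental-free form of `FamilyCriterionAt.two_mul_card_sumSet_periods_le`. -/
theorem NoAccidental.two_mul_card_sumSet_periods_le [Fintype G]
    (hY : ∀ b ∈ T, ∀ b' ∈ T, b ≠ b' → Disjoint (Y b) (Y b'))
    (hZ : ∀ b ∈ T, ∀ b' ∈ T, b ≠ b' → Disjoint (Z b) (Z b'))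
    (hN : NoAccidental (id : G → G) id id (famPairs T X Y) (famPairs T Y Z) (famPairs T Z X))
    {R₁ R₂ : Finset G} (hR₁ : ∀ r ∈ R₁, ∀ s ∈ R₁, r - s ∈ R₁) (hR₂ : ∀ r ∈ R₂, ∀ s ∈ R₂, r - s ∈ R₂)
    (hsat₁ : ∀ d ∈ diffSet (Y t) (Z t), ∀ r ∈ R₁, d + r ∈ diffSet (Y t) (Z t))
    (hsat₂ : ∀ d ∈ diffSet (Y u) (Z u), ∀ r ∈ R₂, d + r ∈ diffSet (Y u) (Z u))
    (ht : t ∈ T) (hu : u ∈ T) (hut : u ≠ t) (hYt : (Y t).Nonempty) (hZt : (Z t).Nonempty)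
    (hYu : (Y u).Nonempty) (hZu : (Z u).Nonempty) :
    2 * (sumSet (X t) (sumSet R₁ R₂)).card ≤ Fintype.card G :=
  (familyCriterion_of_noAccidental hY hZ hN ht).two_mul_card_sumSet_periods_le hR₁ hR₂ hsat₁ hsat₂ hu hut
    hYt hZt hYu hZu

/-- Rows are incongruent modulo a period: `|X_t|·|R₁| ≤ |X_t + (R₁ + R₂)|` whenever `X_t + (Y_t − Z_t)` is uniquely
represented (additive TPP), `R₁` is a period of the nonempty set `Y_t − Z_t`, and `R₂` is nonempty and closed under
subtraction (so `0 ∈ R₂`). -/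
theorem card_mul_card_le_card_sumSet_periods {X₀ Y₀ Z₀ R₁ R₂ : Finset G} (h : AddTPP X₀ Y₀ Z₀)
    (hsat₁ : ∀ d ∈ diffSet Y₀ Z₀, ∀ r ∈ R₁, d + r ∈ diffSet Y₀ Z₀) (hD : (diffSet Y₀ Z₀).Nonempty)
    (hR₂ : ∀ r ∈ R₂, ∀ s ∈ R₂, r - s ∈ R₂) (hR₂ne : R₂.Nonempty) :
    X₀.card * R₁.card ≤ (sumSet X₀ (sumSet R₁ R₂)).card := by
  have h0 : (0 : G) ∈ R₂ := subClosed_zero_mem hR₂ hR₂ne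
  have hcard := h.card_sumSet_translate hsat₁ hD (0 : G)
  have himg : R₁.image (fun r => (0 : G) + r) = R₁ := by
    have : (fun r => (0 : G) + r) = id := by funext r; simp
    rw [this, Finset.image_id]
  rw [himg] at hcard
  rw [← hcard]
  apply Finset.card_le_card
  intro g hg
  obtain ⟨x, hx, r, hr, rfl⟩ := mem_sumSet.mp hg
  exact mem_sumSet.mpr ⟨x, hx, r, mem_sumSet.mpr ⟨r, hr, 0, h0, by abel⟩, rfl⟩

end GridLemma

end Summit.MatrixMultiplication.MatrixMultiplication.Theorems.SoloVal
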